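import Summits.HodgeConjecture.CorCM.CMSixfoldRank.DegreeTwelveCMTypes
import Summits.HodgeConjecture.CorCM.CMSixfoldRank.BalancedQuadraticIsogeny
import Summits.HodgeConjecture.HodgeConjecture.Theorems.Ring2HypothesesAtlasCMSixfolds
import Summits.HodgeConjecture.HodgeConjecture.Theorems.Ring2AtlasCMSixfoldsDegenerateNonVacuity
import Literature.AlgebraicGeometry.Pohlmann1968.SimpleCMAbelianVarietyPowersDivisorGenerated
import Literature.AlgebraicGeometry.Pohlmann1968.NondegenerateCMTypeDivisorGenerated
import Literature.AlgebraicGeometry.Milne1999.CMSimpleIsogenousCMTyped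
import Literature.AlgebraicGeometry.HodgeTheory.HodgeConjectureIsogenyInvariance
import Literature.AlgebraicGeometry.Milne1999.CMTypeSimpleIsogenyFactors
import HarnessLib

/-!
# The ring-2 atlas cell `HodgeNondegenerateCMSixfold` is CLOSED UNCONDITIONALLY, and the whole simple CM sixfold
# row `HodgeSimpleCMSixfold` follows from `W₆` ALONE

Cell `pub-hodgecm2` (COR-CM), count-neutral literature seat `lit-deligne-3` gen 5; KERNEL ONLY (theorems; no
definition, no named fact, `HC_CM` not used).  NEW WORK as assembled (hence under `Summits/`): the combinatorial
input is this directory's theorem `six_le_typeRank_of_card_eq_twelve` (`RankAtLeastSix.lean`: a PRIMITIVE CM type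
on twelve embeddings has Kubota rank `≥ 6`, and rank `6` iff it admits a balanced transversal), which is not in
print (Dodson 1987 Cor. 1.5 treats `n = 2p` only for `p ≥ 5`).  Its number-field dress
(`DegreeTwelveCMTypes.le_cmTypeRank_of_finrank_eq_twelve`: every primitive type of a CM field of degree `12` has
CORANK `≤ 1`) is the standing hypothesis `hrank` of the tree's `Pohlmann1968.CorankOne`
(`Literature/AlgebraicGeometry/Pohlmann1968/CorankOneCMTypeWeilType.lean`, lit-pohlmann), consumed here BY NAME.

## The argument

Let `X` be a simple complex abelian sixfold of CM type (`Ring2.Atlas.IsSimpleCMSixfold`).  By Deligne I 5.1 / Shimura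
§6.2 `X` is isogenous to a realisation `(X', ι, θ)` of a CM type `(K; Φ)`, `[K:ℚ] = 12`, primitive because `X'` is
simple (Shimura §8.2 Prop. 26).  By `RankAtLeastSix`, `Rank(Φ) ∈ {6, 7}`.

* `Rank(Φ) = 7` (nondegenerate): `B•(X'ⁿ) = D•(X'ⁿ)` for all `n` (Hazama / White, the tree's
  `IsNondegenerate.isDivisorGenerated_powSucc_of_isIsogenous`), hence `IsDivisorGenerated X`.
* `Rank(Φ) = 6` (corank one): by `CorankOne` there are an exceptional balanced `6`-set `Δ ∈ pohlmannSets Φ 3 ∖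
  pohlmannDivisorSets Φ 3`, an imaginary quadratic `k = ℚ(√-d) ⊆ K`, `w = √-d ∈ 𝓞_K`, with `Δ = {s | s(w) = i√d}` and
  `|Φ ∩ Δ| = 3` (`exists_sqrt_neg_of_not_isNondegenerate`).  On the realisation, `φ = ι(w)` has `φ ≫ φ = -d` and
  `n_{i√d}(φ) = |{s ∈ Φ | s(w) = i√d}| = 3` (`eigenMultiplicity_eq_ncard_of_isCMTypeRealisation`):
  `HasBalancedQuadraticEndomorphism X'`, which descends along the isogeny to `X`
  (`hasBalancedQuadraticEndomorphism_of_isIsogenous`); moreover `(X', ι w)` is of WEIL TYPE `(3, d)` with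
  `B³ ⊗ ℂ = D³ ⊗ ℂ ⊔ W_k ⊗ ℂ` and `Bᵠ ⊗ ℂ = Dᵠ ⊗ ℂ` for `q ≠ 3` (`CorankOne.hodgeClassSpan_eq_divisorClassesSpan_sup_weilClassesOf`,
  `CorankOne.isDivisorWeilGenerated`), so `X'` is divisor-plus-Weil generated (`IsDivisorMultiWeilGenerated X'`).

Hence **(G₀)**: `IsSimpleCMSixfold X → ¬ HasBalancedQuadraticEndomorphism X → IsDivisorGenerated X` (and all
powers `X^{N+1}` are divisor-generated), the cell `HodgeNondegenerateCMSixfold` follows by ring 2's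
`hodgeNondegenerateCMSixfold_of_isDivisorGenerated` (van Geemen §2.4 + Lefschetz (1,1)); and **(G) up to isogeny**:
every simple CM sixfold is isogenous to a divisor-plus-Weil-generated one, so that — the Hodge conjecture being an
isogeny invariant (van Geemen Lemma 3.7, `HodgeConjectureFor.of_isIsogenous`) — the ROW `HodgeSimpleCMSixfold` and its
degenerate cell `HodgeDegenerateCMSixfold` follow from the Weil-class input `W₆` ALONE
(`hodgeSimpleCMSixfold_of_weilSixfolds`), or from the rung `R∞` (`WeilClassesImaginaryQuadratic`).  No Weil class is
made algebraic here.

## References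

* [Gordon1999HodgeAVSurvey] B. B. Gordon, *A survey of the Hodge conjecture for abelian varieties*, 5.13, Thm. 6.4
  (Hazama), 9.1–9.5 (held `paper:arxiv-alg-geom_9709030` p0017–p0018, p0024).
* [Dodson1987] B. Dodson, J. Algebra 111 (1987), Thm. 1.0, Cor. 1.5 (held `paper:doi-10-1016-0021-8693-87-90242-0`
  p0003–p0004).
* [MoonenZarhin1999LowDim] B. Moonen, Yu. Zarhin, Math. Ann. 315 (1999), Thm. 0.1, §5.
* [MoonenZarhin1998WeilClasses] B. Moonen, Yu. Zarhin, J. reine angew. Math. 496 (1998), §1 (`n_σ`).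
* [Shimura1998] G. Shimura, *Abelian varieties with complex multiplication and modular functions*, §8.2 Prop. 26,
  §8.3 Prop. 28, §18.2.
* [vanGeemen1994HodgeAV] B. van Geemen, LNM 1594 (1994), §2.4, Lemma 3.7, 4.7, 4.9, Thm. 6.12.
* [Deligne1982HodgeCycles] P. Deligne, LNM 900 (1982), I Prop. 5.1 and §5 p. 37; §4 Prop. 4.4, Thm. 4.8.
-/

noncomputable section

open CategoryTheory NumberField
open scoped BigOperators Pointwise Classical

namespace Summit.HodgeConjecture.CorCM.CMSixfoldRank

open Literature.NumberTheory.ComplexMultiplication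
open Literature.AlgebraicGeometry Literature.AlgebraicGeometry.Motives
open Literature.AlgebraicGeometry.Motives.AbelianVariety
open Literature.AlgebraicGeometry.HodgeTheory
open Literature.AlgebraicGeometry.Pohlmann1968
open Literature.AlgebraicGeometry.Pohlmann1968.CorankOne
open Literature.AlgebraicGeometry.ComplexMultiplication (IsCMTypeRealisation isSimple_iff_isPrimitive)
open Literature.AlgebraicGeometry.Milne1999
open Literature.AlgebraicGeometry.VanGeemen1994 (hodgeClassSpan)
open Literature.Barriers.HodgeConjecture (divisorClassesSpan)
open Summit.HodgeConjecture.HodgeConjecture.WeilTypeLadder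
open Summit.HodgeConjecture.HodgeConjecture.Ring2.ClassTargets
open Summit.HodgeConjecture.HodgeConjecture.Ring2.Atlas
open Summit.HodgeConjecture.HodgeConjecture.Ring2.Hypotheses
open Summit.HodgeConjecture.HodgeConjecture.Theses

/-! ### §3 On a realisation of a primitive type of a CM field of degree `12` -/

section Realisation

variable {K : Type} [Field K] [NumberField K] [IsCMField K] {Φ : CMType K}
variable {A : AbelianVariety ℂ} {ι : 𝓞 K →+* End A} {θ : K →+* Module.End ℂ (complexBetti A.X 1)}

omit [NumberField K] [IsCMField K] in
/-- `ι(w) ≫ ι(w) = -d` when `w² = -d` in `𝓞_K`. [folklore] -/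
private theorem comp_self_eq_neg_of_sq_eq_neg (A : AbelianVariety ℂ) (ι : 𝓞 K →+* End A) {w : 𝓞 K} {d : ℕ}
    (hw2 : w ^ 2 = -(d : 𝓞 K)) : ι w ≫ ι w = -(d • 𝟙 A) := by
  rw [← End.mul_def, ← map_mul, ← sq, hw2, map_neg, map_natCast, ← nsmul_one d]
  rfl

/-- **Degenerate primitive type of degree `12` ⟹ `HasBalancedQuadraticEndomorphism` on every realisation**:
`φ = ι(√-d)` has `φ ≫ φ = -d` and `n_{i√d}(φ) = |{s ∈ Φ | s(√-d) = i√d}| = |Φ ∩ Δ| = 3`.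
[cite: MoonenZarhin1999LowDim, Thm. 0.1 (1.4) and §5] [cite: MoonenZarhin1998WeilClasses, §1 (the multiplicities n_σ)]
[cite: vanGeemen1994HodgeAV, 4.7 and 4.9] -/
theorem hasBalancedQuadraticEndomorphism_of_not_isNondegenerate (hK : Module.finrank ℚ K = 12) (φ₀ : K →+* ℂ)
    (hprim : IsPrimitive (ℂ ≃+* ℂ) Φ.1 φ₀) (hA : IsCMTypeRealisation Φ A ι θ) (hdeg : ¬ IsNondegenerate Φ) :
    HasBalancedQuadraticEndomorphism A := by
  obtain ⟨Δ, w, d, -, hd, hw2, -, h3⟩ := exists_sqrt_neg_of_not_isNondegenerate hK φ₀ hprim hdeg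
  refine ⟨ι w, d, hd, comp_self_eq_neg_of_sq_eq_neg A ι hw2, ?_⟩
  rw [eigenMultiplicity_eq_ncard_of_isCMTypeRealisation hA w]
  exact h3

/-- Contrapositive: **no balanced quadratic endomorphism on a realisation ⟹ the type is nondegenerate (`Rank = 7`)**.
[cite: MoonenZarhin1999LowDim, Thm. 0.1 (1.4) and §5] [cite: Dodson1987, Thm. 1.0] -/
theorem isNondegenerate_of_not_hasBalancedQuadraticEndomorphism (hK : Module.finrank ℚ K = 12) (φ₀ : K →+* ℂ)
    (hprim : IsPrimitive (ℂ ≃+* ℂ) Φ.1 φ₀) (hA : IsCMTypeRealisation Φ A ι θ)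
    (hn : ¬ HasBalancedQuadraticEndomorphism A) : IsNondegenerate Φ := by
  by_contra hdeg
  exact hn (hasBalancedQuadraticEndomorphism_of_not_isNondegenerate hK φ₀ hprim hA hdeg)

/-- **The Hodge conjecture on a simple CM abelian SIXFOLD — Gordon's dichotomy 5.13, unconditionally on the rank**
(`CorankOne.hodgeConjectureFor_pow_or_weilType` with `hrank` discharged by `le_cmTypeRank_of_finrank_eq_twelve`): for
every realisation `(A, ι, θ)` of a primitive type of a CM field of degree `12`, EITHER the type is nondegenerate and HC
holds for `A` and all its powers, OR `(A, ι √-d)` is of Weil type `(3, d)`, divisor-plus-Weil generated, and HC(`A`)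
follows from the algebraicity of the rational `(3,3)` classes of its one Weil plane.
[cite: Gordon1999HodgeAVSurvey, 5.13 (i)–(ii) and Thm. 6.4 and 9.5] [cite: vanGeemen1994HodgeAV, Thm. 4.11 and 6.12] -/
theorem hodgeConjectureFor_pow_or_weilType_of_finrank_eq_twelve (hK : Module.finrank ℚ K = 12) (φ₀ : K →+* ℂ)
    (hprim : IsPrimitive (ℂ ≃+* ℂ) Φ.1 φ₀) (hA : IsCMTypeRealisation Φ A ι θ) :
    (IsNondegenerate Φ ∧ HodgeConjectureFor A.dim A.X ∧
        ∀ n : ℕ, HodgeConjectureFor (⨁ fun _ : Fin n => A).dim (⨁ fun _ : Fin n => A).X) ∨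
      ∃ (p : ℕ) (w : 𝓞 K) (d : ℕ), 4 * p = Module.finrank ℚ K ∧ 0 < d ∧ w ^ 2 = -(d : 𝓞 K) ∧
        IsWeilType A (ι w) p d ∧ IsDivisorWeilGenerated A (ι w) p d ∧
        ((∀ c ∈ weilClassesOf A (ι w) p d, IsRationalClass c → IsOfHodgeType (2 * p) A.X (2 * p) p p c →
            c ∈ algebraicClasses A.X p) → HodgeConjectureFor A.dim A.X) :=
  hodgeConjectureFor_pow_or_weilType (le_cmTypeRank_of_finrank_eq_twelve hK φ₀ hprim) φ₀ hprim hA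

/-- **`Bᵠ(A) ⊗ ℂ = Dᵠ(A) ⊗ ℂ` for `q ≠ 3`** on every realisation of a primitive type of a CM field of degree `12`
(van Geemen 6.12's "`dim Bᵖ = 1` for `p ≠ n`": the only interesting degree of a simple CM sixfold is `H⁶`).
[cite: vanGeemen1994HodgeAV, Thm. 6.12] [cite: Gordon1999HodgeAVSurvey, 5.13] -/
theorem hodgeClassSpan_eq_divisorClassesSpan_of_ne_three (hK : Module.finrank ℚ K = 12) (φ₀ : K →+* ℂ)
    (hprim : IsPrimitive (ℂ ≃+* ℂ) Φ.1 φ₀) (hA : IsCMTypeRealisation Φ A ι θ) {q : ℕ} (hq : q ≠ 3) :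
    hodgeClassSpan (Module.finrank ℚ K / 2) A.X q = divisorClassesSpan A.X (Module.finrank ℚ K / 2) q :=
  hodgeClassSpan_eq_divisorClassesSpan_of_ne (le_cmTypeRank_of_finrank_eq_twelve hK φ₀ hprim) φ₀ hprim hA
    (by omega)

/-- **`B³(A) ⊗ ℂ = D³(A) ⊗ ℂ ⊔ W_k ⊗ ℂ` on every realisation of a DEGENERATE primitive type of a CM field of degree
`12`** (van Geemen 6.12 / Gordon 5.13 (ii) for simple CM sixfolds), `k = ℚ(√-d)`, `w = √-d ∈ 𝓞_K`, `(A, ι w)` of Weil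
type `(3, d)`. [cite: vanGeemen1994HodgeAV, Thm. 6.12 and 4.7] [cite: Gordon1999HodgeAVSurvey, 5.13 (ii) and 9.5] -/
theorem exists_hodgeClassSpan_three_eq_sup_weilClassesOf (hK : Module.finrank ℚ K = 12) (φ₀ : K →+* ℂ)
    (hprim : IsPrimitive (ℂ ≃+* ℂ) Φ.1 φ₀) (hA : IsCMTypeRealisation Φ A ι θ) (hdeg : ¬ IsNondegenerate Φ) :
    ∃ (w : 𝓞 K) (d : ℕ), 0 < d ∧ w ^ 2 = -(d : 𝓞 K) ∧ IsWeilType A (ι w) 3 d ∧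
      IsDivisorWeilGenerated A (ι w) 3 d ∧
      hodgeClassSpan (Module.finrank ℚ K / 2) A.X 3 =
        divisorClassesSpan A.X (Module.finrank ℚ K / 2) 3 ⊔ weilClassesOf A (ι w) 3 d := by
  have hrank := le_cmTypeRank_of_finrank_eq_twelve hK φ₀ hprim
  obtain ⟨Δ, w, d, hΔ, hd, hw2, hw, -⟩ := exists_sqrt_neg_of_not_isNondegenerate hK φ₀ hprim hdeg
  have hp4 : 4 * 3 = Module.finrank ℚ K := by rw [hK]
  exact ⟨w, d, hd, hw2,
    (cmEigenclasses_le_weilClassesOf_and_isWeilType hA hp4 (by norm_num) hΔ.1 hd hw2 fun s hs => (hw s).1 hs).2,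
    isDivisorWeilGenerated hrank φ₀ hprim hA hΔ hd hw2 hw,
    hodgeClassSpan_eq_divisorClassesSpan_sup_weilClassesOf hrank φ₀ hprim hA hΔ hd hw2 hw⟩

/-- **Every realisation of a primitive type of a CM field of degree `12` is divisor-plus-Weil generated**
(`Ring2.Hypotheses.IsDivisorMultiWeilGenerated`, the member hypothesis (G) of ring 2's simple CM sixfold row):
`B = D` in the nondegenerate case (Hazama), `B• ⊗ ℂ = D• ⊗ ℂ + W_k ⊗ ℂ` in the corank-one case.
[cite: Gordon1999HodgeAVSurvey, Thm. 6.4 and 5.13] [cite: vanGeemen1994HodgeAV, Thm. 6.12] [cite: MoonenZarhin1999LowDim, §5] -/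
theorem isDivisorMultiWeilGenerated_of_isCMTypeRealisation (hK : Module.finrank ℚ K = 12) (φ₀ : K →+* ℂ)
    (hprim : IsPrimitive (ℂ ≃+* ℂ) Φ.1 φ₀) (hA : IsCMTypeRealisation Φ A ι θ) : IsDivisorMultiWeilGenerated A := by
  by_cases hΦ : IsNondegenerate Φ
  · exact fun p c hc hpp => Submodule.mem_sup_left (hΦ.isDivisorGenerated hA p c hc hpp)
  · obtain ⟨w, d, -, -, hWT, hDW, -⟩ := exists_hodgeClassSpan_three_eq_sup_weilClassesOf hK φ₀ hprim hA hΦ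
    exact isDivisorMultiWeilGenerated_of_isDivisorWeilGenerated hWT hDW

end Realisation

/-! ### §4 (G₀), the nondegenerate cell, and the row from `W₆` alone -/

section Cell

/-- **Every simple complex abelian sixfold of CM type is isogenous to a realisation of a PRIMITIVE CM type of a CM
field of degree `12`** (Deligne I 5.1 / Shimura §6.2 for the realisation, Shimura §8.2 Prop. 26 for primitivity).
[cite: Deligne1982HodgeCycles, I Prop. 5.1 and §5 (p. 37)] [cite: Shimura1998, §8.2 Prop. 26] -/
theorem exists_isCMTypeRealisation_of_isSimpleCMSixfold (X : AbelianVariety ℂ) (hX : IsSimpleCMSixfold X) :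
    ∃ (K : Type) (_ : Field K) (_ : NumberField K) (_ : IsCMField K) (Φ : CMType K) (X' : AbelianVariety ℂ)
      (ι : 𝓞 K →+* End X') (θ : K →+* Module.End ℂ (complexBetti X'.X 1)) (φ₀ : K →+* ℂ),
      IsCMTypeRealisation Φ X' ι θ ∧ Module.finrank ℚ K = 12 ∧ IsPrimitive (ℂ ≃+* ℂ) Φ.1 φ₀ ∧
        AbelianVariety.IsIsogenous X X' := by
  obtain ⟨h6, hs, hcm⟩ := hX
  obtain ⟨X', hX', hiso⟩ := exists_isCMTyped_isIsogenous_of_isSimple X hs (by omega) hcm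
  obtain @⟨K, _, _, _, Φ, _, ι, θ, hA⟩ := hX'
  have hK : Module.finrank ℚ K = 12 := by
    rw [finrank_eq_two_mul_dim_of_isCMTypeRealisation hA, ← (dim_eq_of_isIsogenous_holds hiso : X.dim = X'.dim),
      h6]
  have hne : Nonempty (K →+* ℂ) := by
    rw [← Fintype.card_pos_iff, Embeddings.card, hK]
    omega
  obtain ⟨s₀⟩ := hne
  have hsX' : X'.IsSimple := (isSimple_iff_of_isIsogenous hiso).1 hs
  exact ⟨K, inferInstance, inferInstance, inferInstance, Φ, X', ι, θ, s₀, hA, hK,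
    (isSimple_iff_isPrimitive hA s₀).1 hsX', hiso⟩

/-- **(G₀) with all powers: a simple complex abelian sixfold of CM type without a balanced quadratic endomorphism has
`B•(X^{N+1}) = D•(X^{N+1})` for every `N`** (its CM type is nondegenerate; Hazama).  UNCONDITIONAL.
[cite: Gordon1999HodgeAVSurvey, Thm. 6.4 and 9.4] [cite: MoonenZarhin1999LowDim, §5]
[cite: Deligne1982HodgeCycles, I Prop. 5.1 and §5 (p. 37)] [cite: Shimura1998, §8.2 Prop. 26] -/
theorem isDivisorGenerated_powSucc_of_not_hasBalancedQuadraticEndomorphism (X : AbelianVariety ℂ)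
    (hX : IsSimpleCMSixfold X) (hn : ¬ HasBalancedQuadraticEndomorphism X) (N : ℕ) :
    IsDivisorGenerated (X.powSucc N) := by
  obtain ⟨K, _, _, _, Φ, X', ι, θ, s₀, hA, hK, hprim, hiso⟩ := exists_isCMTypeRealisation_of_isSimpleCMSixfold X hX
  have hn' : ¬ HasBalancedQuadraticEndomorphism X' := fun h =>
    hn (hasBalancedQuadraticEndomorphism_of_isIsogenous hiso h)
  exact (isNondegenerate_of_not_hasBalancedQuadraticEndomorphism hK s₀ hprim hA
    hn').isDivisorGenerated_powSucc_of_isIsogenous hA hiso N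

/-- **(G₀): `IsSimpleCMSixfold X → ¬ HasBalancedQuadraticEndomorphism X → IsDivisorGenerated X`** — the hypothesis
`hgen₀` of ring 2's `hodgeNondegenerateCMSixfold_of_isDivisorGenerated`, now a theorem.  UNCONDITIONAL.
[cite: Gordon1999HodgeAVSurvey, Thm. 6.4 and 9.4] [cite: MoonenZarhin1999LowDim, §5] -/
theorem isDivisorGenerated_of_not_hasBalancedQuadraticEndomorphism (X : AbelianVariety ℂ) (hX : IsSimpleCMSixfold X)
    (hn : ¬ HasBalancedQuadraticEndomorphism X) : IsDivisorGenerated X := by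
  obtain ⟨K, _, _, _, Φ, X', ι, θ, s₀, hA, hK, hprim, hiso⟩ := exists_isCMTypeRealisation_of_isSimpleCMSixfold X hX
  have hn' : ¬ HasBalancedQuadraticEndomorphism X' := fun h =>
    hn (hasBalancedQuadraticEndomorphism_of_isIsogenous hiso h)
  exact ((isNondegenerate_of_not_hasBalancedQuadraticEndomorphism hK s₀ hprim hA hn').isDivisorGenerated
    hA).of_isIsogenous hiso

/-- **The ring-2 atlas cell `HodgeNondegenerateCMSixfold` — the Hodge conjecture for every simple complex abelian
sixfold of CM type WITHOUT a balanced quadratic endomorphism — is a tree theorem, UNCONDITIONALLY** (previously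
`hodgeNondegenerateCMSixfold_of_isDivisorGenerated (hgen₀)` / `…_of_cmAbelianHodge (HC_CM)`).  Its class is
inhabited (`Ring2AtlasCMSixfoldsNondegenerateNonVacuity`). [cite: Gordon1999HodgeAVSurvey, Thm. 6.4 and 9.4]
[cite: MoonenZarhin1999LowDim, §5] [cite: vanGeemen1994HodgeAV, §2.4] [cite: Deligne2000, §1] -/
theorem hodgeNondegenerateCMSixfold_holds : HodgeNondegenerateCMSixfold :=
  hodgeNondegenerateCMSixfold_of_isDivisorGenerated isDivisorGenerated_of_not_hasBalancedQuadraticEndomorphism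

/-- **(G) up to isogeny: every simple complex abelian sixfold of CM type is ISOGENOUS to a divisor-plus-Weil-generated
simple CM sixfold** (a realisation of its primitive type). [cite: vanGeemen1994HodgeAV, Thm. 6.12 and §3.6]
[cite: MoonenZarhin1999LowDim, §5] [cite: Gordon1999HodgeAVSurvey, 5.13] -/
theorem exists_isIsogenous_isDivisorMultiWeilGenerated (X : AbelianVariety ℂ) (hX : IsSimpleCMSixfold X) :
    ∃ X' : AbelianVariety ℂ, IsSimpleCMSixfold X' ∧ IsDivisorMultiWeilGenerated X' ∧
      AbelianVariety.IsIsogenous X X' := by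
  obtain ⟨K, _, _, _, Φ, X', ι, θ, s₀, hA, hK, hprim, hiso⟩ := exists_isCMTypeRealisation_of_isSimpleCMSixfold X hX
  obtain ⟨h6, hs, hcm⟩ := hX
  refine ⟨X', ⟨?_, (isSimple_iff_of_isIsogenous hiso).1 hs, (isOfCMType_iff_of_isIsogenous hiso).1 hcm⟩,
    isDivisorMultiWeilGenerated_of_isCMTypeRealisation hK s₀ hprim hA, hiso⟩
  rw [← (dim_eq_of_isIsogenous_holds hiso : X.dim = X'.dim), h6]

/-- **The ROW `g = 6`, simple, CM-type ⟸ `W₆` ALONE** — both member hypotheses (G₀) and (G) of ring 2's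
`hodgeSimpleCMSixfold_of_generation_of_weilSixfolds` are discharged (up to isogeny, which the Hodge conjecture does
not see: van Geemen Lemma 3.7, `HodgeConjectureFor.of_isIsogenous`).  `W₆ = Theses.SevenfoldWeilCensus.WeilSixfolds`
(Weil classes of Weil-type sixfolds are algebraic) is the ONLY input; `HC_CM` does not occur.
[cite: vanGeemen1994HodgeAV, Lemma 3.7 and Thm. 6.12] [cite: MoonenZarhin1999LowDim, §5]
[cite: Gordon1999HodgeAVSurvey, 5.13 and Thm. 6.4] -/
theorem hodgeSimpleCMSixfold_of_weilSixfolds (hW₆ : SevenfoldWeilCensus.WeilSixfolds) : HodgeSimpleCMSixfold := by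
  intro X hX
  obtain ⟨X', hX', hgen, hiso⟩ := exists_isIsogenous_isDivisorMultiWeilGenerated X hX
  exact HodgeConjectureFor.of_isIsogenous hiso
    (hodgeConjectureFor_of_multiWeilGenerated_of_weilSixfolds hX'.1 hgen hW₆)

/-- **The DEGENERATE cell `HodgeDegenerateCMSixfold` ⟸ `W₆` alone** (member hypothesis (G) discharged).
[cite: vanGeemen1994HodgeAV, Lemma 3.7 and Thm. 6.12] [cite: MoonenZarhin1999LowDim, §5] -/
theorem hodgeDegenerateCMSixfold_of_weilSixfolds (hW₆ : SevenfoldWeilCensus.WeilSixfolds) :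
    HodgeDegenerateCMSixfold :=
  hodgeDegenerateCMSixfold_of_simpleCMSixfold (hodgeSimpleCMSixfold_of_weilSixfolds hW₆)

/-- **The row `g = 6`, simple, CM-type ⟸ the imaginary-quadratic rung `R∞`** (`WeilClassesImaginaryQuadratic`:
Weil classes over imaginary quadratic fields are algebraic, any dimension) in place of `W₆`.
[cite: Deligne1982HodgeCycles, §4 Thm. 4.8] [cite: vanGeemen1994HodgeAV, Lemma 3.7 and Thm. 6.12] -/
theorem hodgeSimpleCMSixfold_of_weilClassesImaginaryQuadratic (hR : WeilClassesImaginaryQuadratic) :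
    HodgeSimpleCMSixfold := by
  intro X hX
  obtain ⟨X', -, hgen, hiso⟩ := exists_isIsogenous_isDivisorMultiWeilGenerated X hX
  exact HodgeConjectureFor.of_isIsogenous hiso
    (hodgeConjectureFor_of_isDivisorMultiWeilGenerated hgen (weilClasses_algebraic_of_weilClassesImaginaryQuadratic hR X'))

/-- **Row `g = 6`, simple, CM-type ⟸ (G) + `W₆`**: ring 2's `hodgeSimpleCMSixfold_of_generation_of_weilSixfolds`
with (G₀) discharged (kept for consumers quoting (G) on the member literally; superseded by
`hodgeSimpleCMSixfold_of_weilSixfolds`). [cite: MoonenZarhin1999LowDim, §5] [cite: vanGeemen1994HodgeAV, §2.4 and Thm. 6.12] -/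
theorem hodgeSimpleCMSixfold_of_degenerate_generation_of_weilSixfolds
    (hgen : ∀ A, IsSimpleCMSixfold A → HasBalancedQuadraticEndomorphism A → IsDivisorMultiWeilGenerated A)
    (hW₆ : SevenfoldWeilCensus.WeilSixfolds) : HodgeSimpleCMSixfold :=
  hodgeSimpleCMSixfold_of_generation_of_weilSixfolds isDivisorGenerated_of_not_hasBalancedQuadraticEndomorphism
    hgen hW₆

/-- **Row `g = 6`, simple, CM-type ⟺ its degenerate cell**: `HodgeSimpleCMSixfold ↔ HodgeDegenerateCMSixfold`.
[cite: MoonenZarhin1999LowDim, §5] -/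
theorem hodgeSimpleCMSixfold_iff_hodgeDegenerateCMSixfold : HodgeSimpleCMSixfold ↔ HodgeDegenerateCMSixfold := by
  rw [hodgeSimpleCMSixfold_iff]
  exact ⟨fun h => h.1, fun h => ⟨h, hodgeNondegenerateCMSixfold_holds⟩⟩

end Cell

end Summit.HodgeConjecture.CorCM.CMSixfoldRank

end
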